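import Literature.NumberTheory.EllipticCurves.HeegnerPointsShimuraReciprocityProofs
import HarnessLib

/-!
# Complex conjugation and the Galois action on PARTIAL SUMS of Heegner points over class cosets
# (the summed form of Gross 1991, Prop. 5.3: the «genus half-trace» law) — THEOREMS ONLY

Topic `NumberTheory/EllipticCurves`. Cell `bsd-goldfeld`, typer seat `bsd-goldfeld-ty` (gen 12); third companion
of the named fact `Literature.NumberTheory.EllipticCurves.heegnerPoints_shimuraReciprocity` (Darmon 2004,
Thms. 3.6/3.7). No definition, no named fact (D-0026).

For a Heegner datum `H` (level `N`, discriminant `d_K`, residue `β`), a predicate `p` on the class group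
`Cl(𝒪_{d_K})` and the partial Heegner sum `z_p = Σ_{Q ∈ H.reps, p([𝔞_Q])} φ(τ_Q) ∈ E(ℂ)`:

* §1 (FACT-FREE) **the summed reflection law**: if `p` is stable under the partner involution
  `c ↦ [𝔫]·c⁻¹` (`[𝔫]` the class of the level form `(N, β, (β² − d_K)/4N)`), then
  `conj z_p = ε z_p − ε · #{Q : p([𝔞_Q])} · φ(0)` (`conjPoint_sum_φ_heegnerTau_filter`), by summing the pointwise
  law `conj φ(τ_Q) = ε φ(τ_{Q*}) − ε φ(0)` (`conjPoint_φ_heegnerTau`) over the bijection `Q ↦ Q*` of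
  `{Q : p([𝔞_Q])}` (`[𝔞_{Q*}] = [𝔫][𝔞_Q]⁻¹`, `classOf'_negB_fricke'`; injective by `heegnerFormClass_injOn_reps`).
  In particular for a coset `p = (· ∈ Cl²·γ₀)` of the squares and `[𝔫] ∈ Cl²` (e.g. `N` a perfect square,
  `heegnerFormClass_levelForm_eq_sq`): `conj z = ε z − ε · #·φ(0)` (`conjPoint_sum_φ_heegnerTau_sqCoset`) — the
  «half-trace relation» `z + z̄ = (h/2^{t})·T` of the genus arguments on `X₀(49)` (`ε = −1`, `φ(0) = T`) BEFORE the
  descent to the genus field (Gross 1991, Prop. 5.3 summed over the coset; seat c201's `halfTrace_conj`).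
* §2 (under `heegnerPoints_shimuraReciprocity`, for any lift family `P` and Artin isomorphism `θ` as provided by the
  fact) **translation-stable partial sums are Galois-fixed**: if `p` is stable under `c ↦ γ·c` then
  `θ(γ)` fixes `Σ_{p([𝔞_Q])} P_Q ∈ E(H_K)` (`map_sum_filter_eq_of_stable`); in particular `θ(δ²)` fixes every
  `Cl²`-coset sum (`map_sq_sum_sqCoset`), i.e. these sums lie in `E` of the fixed field of `θ(Cl²)` (the genus
  field) — Shimura reciprocity "at subgroup level" (planner g28 (cxxxii) (a3)).

## References

* [GrossLMS1991] B. H. Gross, *Kolyvagin's work on modular elliptic curves*, LMS LNS 153 (1991), Prop. 5.3 and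
  proof (held volume `book:editornd-l-functions-arithmetic`, PDF p. 220).
* [Darmon2004] H. Darmon, *Rational Points on Modular Elliptic Curves*, CBMS 101 (2004), Thm. 3.7, Prop. 3.11.
* [Cox2013] D. A. Cox, *Primes of the form x² + ny²*, 2nd ed. (2013), §2.A, §3.B (genera, `C²`), §7.B Thm. 7.7.
-/

noncomputable section

open scoped Classical MatrixGroups

open Literature.NumberTheory.EllipticCurves.ModularForms NumberField CongruenceSubgroup
open Literature.Computability.Cryptography.Hallgren2005
open Literature.Computability.Cryptography.Hallgren2005.OrderCl
open Literature.NumberTheory.QuadraticFields.Quadratic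

universe u

namespace Literature.NumberTheory.EllipticCurves

/-! ### §1 The summed reflection law (fact-free) -/

section Summed

variable {N : ℕ} [NeZero N] {W : WeierstrassCurve ℚ} {K : Type u} [Field K] [NumberField K]

omit [NeZero N] in
/-- A Heegner form of level `N` and discriminant `d_K` is a primitive positive definite `BinQF`. [folklore] -/
private theorem isPosPrim_of_mem' (hK : IsImaginaryQuadratic K) {Q : ℤ × ℤ × ℤ}
    (hQ : Q ∈ heegnerForms N (NumberField.discr K)) :
    (⟨Q.1, Q.2.1, Q.2.2⟩ : BinQF).IsPosPrim hK.negDiscr.D :=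
  ⟨hQ.1, hQ.2.1, (BinQF.isPrimitive_iff _).mpr hQ.2.2.2⟩

/-- Two level-`N` forms `(N, B, C)`, `(N, B', C')` of discriminant `d_K` with `B ≡ B' (mod 2N)` have the same class
(they are translates `T^k` of each other). [cite: Cox2013, §2.A (proper equivalence by T^k)] -/
theorem heegnerFormClass_level_eq_of_modEq (hK : IsImaginaryQuadratic K) {B B' C C' : ℤ}
    (hn : (⟨(N : ℤ), B, C⟩ : BinQF).IsPosPrim hK.negDiscr.D)
    (hn' : (⟨(N : ℤ), B', C'⟩ : BinQF).IsPosPrim hK.negDiscr.D) (hBB' : B ≡ B' [ZMOD 2 * N]) :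
    heegnerFormClass hK ((N : ℤ), B, C) = heegnerFormClass hK ((N : ℤ), B', C') := by
  obtain ⟨k, hk⟩ : ∃ k : ℤ, B' = B + 2 * N * k := by
    obtain ⟨k, hk⟩ := Int.modEq_iff_dvd.mp hBB'
    exact ⟨k, by linarith⟩
  have hT := BinQF.properEquiv_T (⟨(N : ℤ), B, C⟩ : BinQF) k
  have h3 := (hT.isPosPrim hK.negDiscr.neg hn).disc_eq
  have h2 := hn'.disc_eq
  simp only [BinQF.disc] at h2 h3
  have hc : C' = (N : ℤ) * k ^ 2 + B * k + C := by
    apply mul_left_cancel₀ (show (4 : ℤ) * N ≠ 0 from by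
      have : (N : ℤ) ≠ 0 := by exact_mod_cast NeZero.ne N
      positivity)
    rw [hk] at h2
    linarith
  have hform : (⟨(N : ℤ), B', C'⟩ : BinQF) = ⟨(N : ℤ), B + 2 * (N : ℤ) * k, (N : ℤ) * k ^ 2 + B * k + C⟩ :=
    BinQF.ext rfl hk hc
  have hpe : (⟨(N : ℤ), B, C⟩ : BinQF).ProperEquiv ⟨(N : ℤ), B', C'⟩ := by rw [hform]; exact hT
  exact (classOf'_eq_classOf'_iff_properEquiv hK.negDiscr hn hn').mpr hpe

/-- **The class `[𝔫]` of the level ideal, read on any representative**: for `Q = (A, B, C) ∈ H.reps`,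
`[𝔞_{(N, B, AC/N)}] = [𝔞_{(N, β, (β² − d_K)/4N)}]`. [cite: Gross1984, §I.1 (the ideal 𝔫)] -/
theorem heegnerFormClass_levelForm_eq_datum (hK : IsImaginaryQuadratic K)
    (hND : ∀ p : ℕ, p.Prime → p ∣ N → ¬ (p : ℤ) ∣ NumberField.discr K)
    (H : HeegnerDatum N (NumberField.discr K)) {Q : ℤ × ℤ × ℤ} (hQ : Q ∈ H.reps) :
    heegnerFormClass hK ((N : ℤ), Q.2.1, Q.1 / N * Q.2.2) =
      heegnerFormClass hK ((N : ℤ), H.β, (H.β ^ 2 - NumberField.discr K) / (4 * N)) := by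
  obtain ⟨hQf, hβ⟩ := H.mem_heegnerForms Q hQ
  exact heegnerFormClass_level_eq_of_modEq hK (isPosPrim_levelForm hK.negDiscr hND hQf)
    (isPosPrim_of_mem' hK (levelForm_mem_heegnerForms hND H)) hβ

/-- **The summed reflection law (Gross 1991, Prop. 5.3, summed over a partner-stable set of classes).** Let `p` be a
predicate on `Cl(𝒪_{d_K})` stable under `c ↦ [𝔫]·c⁻¹`. Then for the partial Heegner sum over the representatives
with `p([𝔞_Q])`, in `E(ℂ)`: `conj Σ φ(τ_Q) = ε Σ φ(τ_Q) − ε · #{Q} · φ(0)` (`ε = ±1` the Fricke eigenvalue, `φ(0)`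
the rational torsion image of the cusp `0`). Fact-free: the pointwise law `conjPoint_φ_heegnerTau` summed along the
bijection `Q ↦ Q*` (representative of `(CN, B, A/N)`, class `[𝔫][𝔞_Q]⁻¹`) of the index set.
[cite: GrossLMS1991, Prop. 5.3 and proof (PDF p. 220)] -/
theorem conjPoint_sum_φ_heegnerTau_filter [W.IsElliptic] (hK : IsImaginaryQuadratic K)
    (hH : SatisfiesHeegnerHypothesis N K) (Dt : ModularParametrizationData W N)
    (H : HeegnerDatum N (NumberField.discr K)) {e : ℤ} (hW : ModularForms.IsFrickeEigen N Dt.f (e : ℂ))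
    (he : e = 1 ∨ e = -1) (p : ClassGroup (OrderCl.QO hK.negDiscr) → Prop)
    (hp : ∀ c, p (heegnerFormClass hK ((N : ℤ), H.β, (H.β ^ 2 - NumberField.discr K) / (4 * N)) * c⁻¹) ↔ p c) :
    conjPoint W (∑ Q ∈ H.reps.filter (fun Q ↦ p (heegnerFormClass hK Q)), Dt.φ (heegnerTau Q)) =
      e • (∑ Q ∈ H.reps.filter (fun Q ↦ p (heegnerFormClass hK Q)), Dt.φ (heegnerTau Q)) -
        e • ((H.reps.filter (fun Q ↦ p (heegnerFormClass hK Q))).card • Dt.cuspZeroPoint) := by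
  have hND : ∀ p : ℕ, p.Prime → p ∣ N → ¬ (p : ℤ) ∣ NumberField.discr K :=
    fun p hp hpN ↦ not_dvd_discr_of_satisfiesHeegnerHypothesis hK hH hp hpN
  set F := H.reps.filter (fun Q ↦ p (heegnerFormClass hK Q)) with hF
  -- the partner representative `π Q` of `Q* = (CN, B, A/N)`
  have hstar : ∀ Q ∈ H.reps, ∃ Q' ∈ H.reps,
      IsGamma0Equiv N (HeegnerForm.negB (HeegnerForm.fricke N Q)) Q' := fun Q hQ ↦ by
    obtain ⟨hQf, hβ⟩ := H.mem_heegnerForms Q hQ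
    exact H.exists_isGamma0Equiv _
      (HeegnerForm.negB_mem_heegnerForms (HeegnerForm.fricke_mem_heegnerForms hK.discr_neg hND hQf))
      (by simpa using hβ)
  choose! π hπ_mem hπ using hstar
  -- its class and its value under `φ`
  have hπ_class : ∀ Q ∈ H.reps, heegnerFormClass hK (π Q) =
      heegnerFormClass hK ((N : ℤ), H.β, (H.β ^ 2 - NumberField.discr K) / (4 * N)) *
        (heegnerFormClass hK Q)⁻¹ := fun Q hQ ↦ by
    obtain ⟨hQf, -⟩ := H.mem_heegnerForms Q hQ
    have hstarf := HeegnerForm.negB_mem_heegnerForms (HeegnerForm.fricke_mem_heegnerForms hK.discr_neg hND hQf)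
    rw [← heegnerFormClass_eq_of_isGamma0Equiv hK hstarf (H.mem_heegnerForms _ (hπ_mem Q hQ)).1 (hπ Q hQ),
      ← heegnerFormClass_levelForm_eq_datum hK hND H hQ]
    exact classOf'_negB_fricke' hK.negDiscr hND hQf
  have hπ_φ : ∀ Q ∈ H.reps, Dt.φ (heegnerTau (π Q)) =
      Dt.φ (heegnerTau (HeegnerForm.negB (HeegnerForm.fricke N Q))) := fun Q hQ ↦ by
    obtain ⟨γ, hγ⟩ := hπ Q hQ
    rw [← hγ, Dt.φ_gamma0_smul_holds (ModularForms.eichlerIntegral_gamma_smul_holds Dt.f) γ]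
  -- `π` is a bijection of `F`
  have hπ_F : ∀ Q ∈ F, π Q ∈ F := fun Q hQ ↦ by
    rw [hF, Finset.mem_filter] at hQ ⊢
    exact ⟨hπ_mem Q hQ.1, by rw [hπ_class Q hQ.1]; exact (hp _).mpr hQ.2⟩
  have hπ_inj : Set.InjOn π F := fun Q₁ hQ₁ Q₂ hQ₂ h ↦ by
    rw [hF, Finset.coe_filter] at hQ₁ hQ₂
    have h' := congrArg (heegnerFormClass hK) h
    rw [hπ_class Q₁ hQ₁.1, hπ_class Q₂ hQ₂.1] at h'
    exact heegnerFormClass_injOn_reps hK H hQ₁.1 hQ₂.1 (inv_injective (mul_left_cancel h'))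
  -- sum the pointwise law
  rw [map_sum]
  have hpt : ∀ Q ∈ F, conjPoint W (Dt.φ (heegnerTau Q)) =
      e • Dt.φ (heegnerTau (π Q)) - e • Dt.cuspZeroPoint := fun Q hQ ↦ by
    have hQr := (Finset.mem_filter.mp hQ).1
    rw [hπ_φ Q hQr, conjPoint_φ_heegnerTau Dt hW he hK.discr_neg (H.mem_heegnerForms Q hQr).1]
  rw [Finset.sum_congr rfl hpt, Finset.sum_sub_distrib, Finset.sum_const, ← Finset.smul_sum, smul_comm]
  congr 2
  exact Finset.sum_nbij π hπ_F hπ_inj (Finset.surjOn_of_injOn_of_card_le π hπ_F hπ_inj le_rfl)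
    (fun _ _ ↦ rfl)

/-- A coset `Cl²·γ₀` of the subgroup of squares is stable under `c ↦ ν·c⁻¹` whenever `ν` is a square class.
[cite: Cox2013, §3.B (the principal genus and C²)] -/
theorem sqCoset_stable {G : Type*} [CommGroup G] {ν γ₀ : G} (hν : ∃ μ, ν = μ ^ 2) (c : G) :
    (∃ δ, ν * c⁻¹ = δ ^ 2 * γ₀) ↔ ∃ δ, c = δ ^ 2 * γ₀ := by
  obtain ⟨μ, rfl⟩ := hν
  constructor
  · rintro ⟨δ, hδ⟩
    refine ⟨μ * δ⁻¹ * γ₀⁻¹, ?_⟩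
    have hc : c⁻¹ = (μ ^ 2)⁻¹ * (δ ^ 2 * γ₀) := eq_inv_mul_of_mul_eq hδ
    rw [← inv_inv c, hc]
    apply Additive.ofMul.injective
    simp only [ofMul_mul, ofMul_inv, ofMul_pow]
    abel
  · rintro ⟨δ, rfl⟩
    refine ⟨μ * δ⁻¹ * γ₀⁻¹, ?_⟩
    apply Additive.ofMul.injective
    simp only [ofMul_mul, ofMul_inv, ofMul_pow]
    abel

/-- **The «genus half-trace» reflection law.** For a coset `Cl²·γ₀` of the squares and the partial Heegner sum
`z = Σ_{[𝔞_Q] ∈ Cl²γ₀} φ(τ_Q)`, if the level class `[𝔫]` is a square (e.g. `N` a perfect square,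
`heegnerFormClass_levelForm_eq_sq`) then `conj z = ε z − ε · # · φ(0)` in `E(ℂ)`: the coset is stable under the
partner involution (`sqCoset_stable`). For `X₀(49)` over `ℚ(√−q)` this is the relation `z + z̄ = (h/2)·T` of the
half-trace argument (`ε = −1`, `φ(0) = T`), before descent to the genus field.
[cite: GrossLMS1991, Prop. 5.3 and proof (PDF p. 220)] [cite: Darmon2004, Prop. 3.11] -/
theorem conjPoint_sum_φ_heegnerTau_sqCoset [W.IsElliptic] (hK : IsImaginaryQuadratic K)
    (hH : SatisfiesHeegnerHypothesis N K) (Dt : ModularParametrizationData W N)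
    (H : HeegnerDatum N (NumberField.discr K)) {e : ℤ} (hW : ModularForms.IsFrickeEigen N Dt.f (e : ℂ))
    (he : e = 1 ∨ e = -1) (γ₀ : ClassGroup (OrderCl.QO hK.negDiscr))
    (hν : ∃ μ, heegnerFormClass hK ((N : ℤ), H.β, (H.β ^ 2 - NumberField.discr K) / (4 * N)) = μ ^ 2) :
    conjPoint W (∑ Q ∈ H.reps.filter (fun Q ↦ ∃ δ, heegnerFormClass hK Q = δ ^ 2 * γ₀), Dt.φ (heegnerTau Q)) =
      e • (∑ Q ∈ H.reps.filter (fun Q ↦ ∃ δ, heegnerFormClass hK Q = δ ^ 2 * γ₀), Dt.φ (heegnerTau Q)) -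
        e • ((H.reps.filter (fun Q ↦ ∃ δ, heegnerFormClass hK Q = δ ^ 2 * γ₀)).card • Dt.cuspZeroPoint) :=
  conjPoint_sum_φ_heegnerTau_filter hK hH Dt H hW he (fun c ↦ ∃ δ, c = δ ^ 2 * γ₀)
    (fun c ↦ sqCoset_stable hν c)

end Summed

/-! ### §2 Translation-stable partial sums are fixed by the corresponding Galois elements (under the fact) -/

section Galois

variable {N : ℕ} {W : WeierstrassCurve ℚ} {K : Type u} [Field K] [NumberField K]

/-- **Shimura reciprocity at subgroup level.** Let `P`, `θ` be a lift family and an Artin isomorphism with the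
transport law of `heegnerPoints_shimuraReciprocity` (`hθ`). If the predicate `p` on classes is stable under
`c ↦ γ·c`, then `θ(γ)` FIXES the partial sum `Σ_{p([𝔞_Q])} P_Q ∈ E(H_K)`: it permutes its summands
(`[𝔞_{Q'}] = γ[𝔞_Q]`, injectivity of `Q ↦ [𝔞_Q]` on representatives).
[cite: Darmon2004, Thm. 3.7] -/
theorem map_sum_filter_eq_of_stable (hK : IsImaginaryQuadratic K) (H : HeegnerDatum N (NumberField.discr K))
    (ι : K →+* ℂ) (P : H.reps → (W.baseChange (singularModuliField K ι)).toAffine.Point)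
    (θ : ClassGroup (OrderCl.QO hK.negDiscr) ≃* (singularModuliField K ι ≃ₐ[K] singularModuliField K ι))
    (hθ : ∀ (γ : ClassGroup (OrderCl.QO hK.negDiscr)) (q : H.reps), ∃ q' : H.reps,
      heegnerFormClass hK q' = γ * heegnerFormClass hK q ∧
      WeierstrassCurve.Affine.Point.map
        (θ γ : singularModuliField K ι →ₐ[K] singularModuliField K ι) (P q) = P q')
    (γ : ClassGroup (OrderCl.QO hK.negDiscr)) (p : ClassGroup (OrderCl.QO hK.negDiscr) → Prop)
    (hp : ∀ c, p (γ * c) ↔ p c) :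
    WeierstrassCurve.Affine.Point.map (θ γ : singularModuliField K ι →ₐ[K] singularModuliField K ι)
        (∑ q ∈ Finset.univ.filter (fun q : H.reps ↦ p (heegnerFormClass hK q)), P q) =
      ∑ q ∈ Finset.univ.filter (fun q : H.reps ↦ p (heegnerFormClass hK q)), P q := by
  set F := Finset.univ.filter (fun q : H.reps ↦ p (heegnerFormClass hK q)) with hF
  choose e he using hθ γ
  have he_F : ∀ q ∈ F, e q ∈ F := fun q hq ↦ by
    rw [hF, Finset.mem_filter] at hq ⊢
    exact ⟨Finset.mem_univ _, by rw [(he q).1]; exact (hp _).mpr hq.2⟩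
  have he_inj : Set.InjOn e F := fun q₁ _ q₂ _ h ↦ by
    have h₁ := (he q₁).1
    have h₂ := (he q₂).1
    rw [h] at h₁
    exact heegnerFormClass_injective_reps hK H (mul_left_cancel (h₁.symm.trans h₂))
  rw [map_sum]
  calc ∑ q ∈ F, WeierstrassCurve.Affine.Point.map
          (θ γ : singularModuliField K ι →ₐ[K] singularModuliField K ι) (P q)
      = ∑ q ∈ F, P (e q) := Finset.sum_congr rfl fun q _ ↦ (he q).2
    _ = ∑ q ∈ F, P q :=
        Finset.sum_nbij e he_F he_inj (Finset.surjOn_of_injOn_of_card_le e he_F he_inj le_rfl) (fun _ _ ↦ rfl)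

/-- **Squares fix the `Cl²`-coset sums**: with `P`, `θ` as above, `θ(δ²)` fixes `Σ_{[𝔞_Q] ∈ Cl²γ₀} P_Q` for every `δ`
— these partial sums lie in `E` of the fixed field of `θ(Cl²)` (the genus field of `K`), the «half-traces» of the
genus arguments. [cite: Darmon2004, Thm. 3.7] [cite: Cox2013, §3.B] -/
theorem map_sq_sum_sqCoset (hK : IsImaginaryQuadratic K) (H : HeegnerDatum N (NumberField.discr K))
    (ι : K →+* ℂ) (P : H.reps → (W.baseChange (singularModuliField K ι)).toAffine.Point)
    (θ : ClassGroup (OrderCl.QO hK.negDiscr) ≃* (singularModuliField K ι ≃ₐ[K] singularModuliField K ι))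
    (hθ : ∀ (γ : ClassGroup (OrderCl.QO hK.negDiscr)) (q : H.reps), ∃ q' : H.reps,
      heegnerFormClass hK q' = γ * heegnerFormClass hK q ∧
      WeierstrassCurve.Affine.Point.map
        (θ γ : singularModuliField K ι →ₐ[K] singularModuliField K ι) (P q) = P q')
    (γ₀ δ : ClassGroup (OrderCl.QO hK.negDiscr)) :
    WeierstrassCurve.Affine.Point.map (θ (δ ^ 2) : singularModuliField K ι →ₐ[K] singularModuliField K ι)
        (∑ q ∈ Finset.univ.filter (fun q : H.reps ↦ ∃ δ', heegnerFormClass hK q = δ' ^ 2 * γ₀), P q) =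
      ∑ q ∈ Finset.univ.filter (fun q : H.reps ↦ ∃ δ', heegnerFormClass hK q = δ' ^ 2 * γ₀), P q := by
  refine map_sum_filter_eq_of_stable hK H ι P θ hθ (δ ^ 2) (fun c ↦ ∃ δ', c = δ' ^ 2 * γ₀) fun c ↦ ?_
  constructor
  · rintro ⟨δ', h⟩
    refine ⟨δ' * δ⁻¹, ?_⟩
    rw [eq_inv_mul_of_mul_eq h]
    apply Additive.ofMul.injective
    simp only [ofMul_mul, ofMul_inv, ofMul_pow]
    abel
  · rintro ⟨δ', rfl⟩
    exact ⟨δ * δ', by rw [mul_pow, mul_assoc]⟩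

end Galois

end Literature.NumberTheory.EllipticCurves

end
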